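import Summits.Parity.GeneralizedHardyLittlewood.Theorems.PrimeLevelFamEdgeMomentsBeyondDiagonalLayersClassSplit
import Summits.Parity.GeneralizedHardyLittlewood.Theorems.PrimeLevelFamEdgeMomentsBeyondDiagonalLayersClassPascadi
import Summits.Parity.GeneralizedHardyLittlewood.Theorems.PrimeLevelFamEdgeMomentsBeyondDiagonalLayersClassCoeffL2
import HarnessLib

/-!
# Route `PrimeLevelFamEdge`, crux K_A `MomentsBeyondDiagonal` (stmt-Parity-20007), line «petersson_layers» v4:
# the PER-CLASS BOUND of `stub_farP`'s `k = 0` forms in closed form (assembly step E4, CONDITIONAL on Pascadi's Thm 7.1)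

The plug: for one `(d₁,d₂)`-block and one sharp class `(s₁,t₁,s₂,t₂)` of the `k = 0` form (`…LayersClassSplit`), with
`g = ((s₁t₁,s₂t₂), qr)`, class modulus `qr/g = q·(r/g)` (`q ∤ s₁t₁`, `q ∤ r`), dilations `σ₁' = s₁t₁/g`, `σ₂' = s₂t₂/g`, flat boxes
`Z₁ = M/d₁/s₁`, `Z₂ = M/d₂/s₂`, `W₁ = q²/d₁/t₁`, `W₂ = q²/d₂/t₂` and hyperbolic AFE length `V = Y/(d₁t₁·d₂t₂)`, the class form is
bounded by Pascadi's Theorem 7.1 on the hyperbolic box (`…LayersClassPascadi`) with the `ℓ²` sizes of `…LayersClassCoeffL2` and the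
coprimality of `…LayersClassKernel.coprime_class_normal_form`:
* **`norm_classForm_le_of_pascadi`** (ordering `σ₂'V ≤ σ₁'Z₁Z₂ ≤ qr/g`) and **`norm_classForm_le_of_pascadi'`** (`σ₁'Z₁Z₂ ≤ σ₂'V ≤ qr/g`):
  `‖class form‖ ≤ C_ε √D₁√D₂ · B²√(Z₁Z₂) · K L √((1+2log q)·Y/(d₁t₁d₂t₂)) · (qr/g)^{1+ε} · bracket71(…)^{1/6}`
  (divisor bounds `D₁` on `[1,Z₁Z₂]`, `D₂` on `[1,W₁W₂]` as hypotheses).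
Remaining (census E4''/E5b/E6/E7): the dilated-Parseval twin for `σ₁'Z₁Z₂ > qr/g`, the sum over classes and blocks with the exponent
bookkeeping, `q ∣ r`, the final instantiation; NOT done here.  Proof only (def-free, CONDITIONAL helper); K_A NOT proved; nothing of
Pascadi's proof is formalised; nothing about Landau–Siegel zeros.
-/

noncomputable section

open scoped Real Nat
open Complex Finset Polynomial MeasureTheory
open Literature.NumberTheory.LFunctions

namespace Summit.Parity.GeneralizedHardyLittlewood.Theorems.MomentsBeyondDiagonal.Layers

open Summit.Parity.GeneralizedHardyLittlewood.Theorems.PrimeLevelFamEdgeIdeaDeltas.PeterssonLayers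

/-- The symmetric twin of `classGcd_dvd_right`: if `q ∤ σ₂` then `g = ((σ₁,σ₂), qr)` divides `r` and `qr/g = q·(r/g)`. [folklore] -/
theorem classGcd_dvd_right' {q r σ₁ σ₂ : ℕ} (hq : q.Prime) (hσ₂ : ¬ q ∣ σ₂) :
    Nat.gcd (Nat.gcd σ₁ σ₂) (q * r) ∣ r ∧ q * r / Nat.gcd (Nat.gcd σ₁ σ₂) (q * r) = q * (r / Nat.gcd (Nat.gcd σ₁ σ₂) (q * r)) := by
  set g := Nat.gcd (Nat.gcd σ₁ σ₂) (q * r) with hg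
  have hgσ₂ : g ∣ σ₂ := (Nat.gcd_dvd_left _ _).trans (Nat.gcd_dvd_right σ₁ σ₂)
  have hgq : Nat.Coprime g q := by
    rw [Nat.coprime_comm, hq.coprime_iff_not_dvd]
    exact fun h ↦ hσ₂ (h.trans hgσ₂)
  have hgr : g ∣ r := hgq.dvd_of_dvd_mul_left (Nat.gcd_dvd_right _ _)
  exact ⟨hgr, Nat.mul_div_assoc q hgr⟩

/-- Pascadi's coprimality for the class coefficients: if `A_s(f₁,f₂)·B_t(h₁,h₂) ≠ 0` then all four flats are prime to `c` and
`(((s₁t₁/g)f₁f₂, (s₂t₂/g)h₁h₂), c/g) = 1`. [folklore] -/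
theorem coprime_of_classCoeff_ne_zero {c : ℕ} (hc : c ≠ 0) (s₁ t₁ s₂ t₂ : ℕ) (a b : ℕ → ℕ → ℂ) {f₁ h₁ f₂ h₂ : ℕ}
    (hne : (if Nat.Coprime f₁ c ∧ Nat.Coprime f₂ c then a (s₁ * f₁) (s₂ * f₂) else 0) *
      (if Nat.Coprime h₁ c ∧ Nat.Coprime h₂ c then b (t₁ * h₁) (t₂ * h₂) else 0) ≠ 0) :
    Nat.Coprime
      (Nat.gcd (s₁ * t₁ / Nat.gcd (Nat.gcd (s₁ * t₁) (s₂ * t₂)) c * (f₁ * f₂))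
        (s₂ * t₂ / Nat.gcd (Nat.gcd (s₁ * t₁) (s₂ * t₂)) c * (h₁ * h₂)))
      (c / Nat.gcd (Nat.gcd (s₁ * t₁) (s₂ * t₂)) c) := by
  have hF : Nat.Coprime f₁ c ∧ Nat.Coprime f₂ c := by
    by_contra h
    exact hne (by rw [if_neg h, zero_mul])
  have hH : Nat.Coprime h₁ c ∧ Nat.Coprime h₂ c := by
    by_contra h
    exact hne (by rw [if_neg h, mul_zero])
  exact coprime_class_normal_form hc s₁ t₁ s₂ t₂ hF.1 hH.1 hF.2 hH.2

/-- `√(Σ‖A_s‖²) ≤ B²√(Z₁Z₂)` and `√(Σ‖B_t‖²) ≤ KL√((1+2log q)·Y/(d₁t₁d₂t₂))` (square roots of `…LayersClassCoeffL2`). [folklore] -/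
theorem sqrt_classCoeff_le {q : ℕ} [NeZero q] (h64 : 64 ≤ q) {P : ℝ[X]} {B : ℝ}
    (hB : ∀ t ∈ Set.Icc (0 : ℝ) 1, |P.eval t| ≤ B) {Δ' : ℝ} (hΔ' : 0 < Δ') (i j : ℕ) {K : ℝ} (hK0 : 0 ≤ K)
    (hK : ∀ {N₁ N₂ : ℕ}, N₁ ∈ afeBox q → N₂ ∈ afeBox q →
      ‖((((N₁ : ℝ) * N₂) ^ (-(1 / 2 : ℝ)) : ℝ) : ℂ) * afeW (KMV2000.qhat q) i j N₁ N₂‖ *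
          Real.sqrt ((N₁ : ℝ) * N₂) ≤
        K * ((1 + Real.log (KMV2000.qhat q)) * (1 + 2 * Real.log q)) ^ (i + j) *
          (KMV2000.qhat q ^ 2 / ((N₁ : ℝ) * N₂)) ^ (0 : ℝ))
    (c Y : ℕ) {d₁ d₂ s₁ t₁ s₂ t₂ : ℕ} (hd₁ : 1 ≤ d₁) (hd₂ : 1 ≤ d₂) (hs₁ : 1 ≤ s₁) (hs₂ : 1 ≤ s₂)
    (ht₁ : 1 ≤ t₁) (ht₂ : 1 ≤ t₂) :
    Real.sqrt (∑ p ∈ Icc 1 (⌊KMV2000.qhat q ^ Δ'⌋₊ / d₁ / s₁) ×ˢ Icc 1 (⌊KMV2000.qhat q ^ Δ'⌋₊ / d₂ / s₂),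
      ‖(if Nat.Coprime p.1 c ∧ Nat.Coprime p.2 c then
          (KMV2000.mollifierCoeff P (KMV2000.qhat q ^ Δ') (d₁ * (s₁ * p.1)) : ℂ) *
            (KMV2000.mollifierCoeff P (KMV2000.qhat q ^ Δ') (d₂ * (s₂ * p.2)) : ℂ) *
            ((Real.sqrt ((s₁ * p.1 : ℕ) : ℝ) * Real.sqrt ((s₂ * p.2 : ℕ) : ℝ) : ℝ) : ℂ) else 0)‖ ^ 2) ≤
      B ^ 2 * Real.sqrt (((⌊KMV2000.qhat q ^ Δ'⌋₊ / d₁ / s₁ : ℕ) : ℝ) * ((⌊KMV2000.qhat q ^ Δ'⌋₊ / d₂ / s₂ : ℕ) : ℝ)) ∧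
    Real.sqrt (∑ p ∈ Icc 1 (q ^ 2 / d₁ / t₁) ×ˢ Icc 1 (q ^ 2 / d₂ / t₂),
      ‖(if Nat.Coprime p.1 c ∧ Nat.Coprime p.2 c then
          (if d₁ * (t₁ * p.1) * (d₂ * (t₂ * p.2)) ≤ Y then
              ((((((d₁ * (t₁ * p.1) : ℕ) : ℝ) * ((d₂ * (t₂ * p.2) : ℕ) : ℝ)) ^ (-(1 / 2 : ℝ)) : ℝ) : ℂ) *
                afeW (KMV2000.qhat q) i j (d₁ * (t₁ * p.1)) (d₂ * (t₂ * p.2))) else 0) *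
            ((Real.sqrt ((t₁ * p.1 : ℕ) : ℝ) * Real.sqrt ((t₂ * p.2 : ℕ) : ℝ) : ℝ) : ℂ) else 0)‖ ^ 2) ≤
      K * ((1 + Real.log (KMV2000.qhat q)) * (1 + 2 * Real.log q)) ^ (i + j) *
        Real.sqrt ((1 + 2 * Real.log q) * ((Y : ℝ) / (((d₁ * t₁ : ℕ) : ℝ) * ((d₂ * t₂ : ℕ) : ℝ)))) := by
  have hqh1 : 1 < KMV2000.qhat q := one_lt_qhat h64
  have hB0 : 0 ≤ B := le_trans (abs_nonneg _) (hB 0 (by simp))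
  have hlq : 0 ≤ Real.log (q : ℝ) := Real.log_nonneg (by exact_mod_cast (le_trans (by norm_num) h64 : 1 ≤ q))
  have hL0 : 0 ≤ ((1 + Real.log (KMV2000.qhat q)) * (1 + 2 * Real.log q)) ^ (i + j) := by
    refine pow_nonneg (mul_nonneg ?_ ?_) _
    · linarith [Real.log_nonneg hqh1.le]
    · linarith
  have hA := normSq_sum_classMollifier_le h64 hB hΔ' c hd₁ hd₂ hs₁ hs₂
  have hBt := normSq_sum_classAFE_le h64 i j hK0 hK c Y hd₁ hd₂ ht₁ ht₂
  refine ⟨(Real.sqrt_le_sqrt hA).trans_eq ?_, (Real.sqrt_le_sqrt hBt).trans_eq ?_⟩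
  · rw [Real.sqrt_mul (by positivity), show B ^ 4 = (B ^ 2) ^ 2 by ring, Real.sqrt_sq (by positivity)]
  · rw [mul_assoc, Real.sqrt_mul (by positivity), Real.sqrt_sq (by positivity)]

/-- **The per-class bound, ordering `σ₂'V ≤ σ₁'Z₁Z₂ ≤ qr/g`** (CONDITIONAL on `pascadi2025_theorem71`; `q ≥ 64` prime, `q ∤ r`,
class `(s₁,t₁,s₂,t₂)` with `q ∤ s₁ * t₁`, `g = ((s₁t₁,s₂t₂),qr)`; divisor bounds `D₁, D₂` as hypotheses).
[cite: Pascadi2025, Thm. 7.1 (case c = q·(r/g), a = 1)] -/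
theorem norm_classForm_le_of_pascadi (h : pascadi2025_theorem71) {ε : ℝ} (hε : 0 < ε) :
    ∃ C : ℝ, 0 ≤ C ∧ ∀ (q : ℕ) [NeZero q], 64 ≤ q → q.Prime → ∀ (r : ℕ), ¬ q ∣ r →
      ∀ (P : ℝ[X]) (B : ℝ), (∀ t ∈ Set.Icc (0 : ℝ) 1, |P.eval t| ≤ B) → ∀ (Δ' : ℝ), 0 < Δ' →
      ∀ (i j : ℕ) (K : ℝ), 0 ≤ K →
        (∀ {N₁ N₂ : ℕ}, N₁ ∈ afeBox q → N₂ ∈ afeBox q →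
          ‖((((N₁ : ℝ) * N₂) ^ (-(1 / 2 : ℝ)) : ℝ) : ℂ) * afeW (KMV2000.qhat q) i j N₁ N₂‖ *
              Real.sqrt ((N₁ : ℝ) * N₂) ≤
            K * ((1 + Real.log (KMV2000.qhat q)) * (1 + 2 * Real.log q)) ^ (i + j) *
              (KMV2000.qhat q ^ 2 / ((N₁ : ℝ) * N₂)) ^ (0 : ℝ)) →
      ∀ (Y d₁ d₂ s₁ t₁ s₂ t₂ g : ℕ) [NeZero (q * r / g)],
        1 ≤ d₁ → 1 ≤ d₂ → 1 ≤ s₁ → 1 ≤ s₂ → 1 ≤ t₁ → 1 ≤ t₂ →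
        g = Nat.gcd (Nat.gcd (s₁ * t₁) (s₂ * t₂)) (q * r) → ¬ q ∣ s₁ * t₁ →
        1 ≤ s₂ * t₂ / g * (Y / (d₁ * t₁ * (d₂ * t₂))) → s₂ * t₂ / g * (Y / (d₁ * t₁ * (d₂ * t₂))) ≤ s₁ * t₁ / g * ((⌊KMV2000.qhat q ^ Δ'⌋₊ / d₁ / s₁) * (⌊KMV2000.qhat q ^ Δ'⌋₊ / d₂ / s₂)) →
        s₁ * t₁ / g * ((⌊KMV2000.qhat q ^ Δ'⌋₊ / d₁ / s₁) * (⌊KMV2000.qhat q ^ Δ'⌋₊ / d₂ / s₂)) ≤ q * r / g →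
        Y / (d₁ * t₁ * (d₂ * t₂)) ≤ (q ^ 2 / d₁ / t₁) * (q ^ 2 / d₂ / t₂) →
      ∀ (D₁ D₂ : ℝ), 0 ≤ D₁ → 0 ≤ D₂ →
        (∀ u ∈ Icc 1 ((⌊KMV2000.qhat q ^ Δ'⌋₊ / d₁ / s₁) * (⌊KMV2000.qhat q ^ Δ'⌋₊ / d₂ / s₂)), (#u.divisors : ℝ) ≤ D₁) →
        (∀ v ∈ Icc 1 ((q ^ 2 / d₁ / t₁) * (q ^ 2 / d₂ / t₂)), (#v.divisors : ℝ) ≤ D₂) →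
        ‖∑ f₁ ∈ Icc 1 (⌊KMV2000.qhat q ^ Δ'⌋₊ / d₁ / s₁), ∑ h₁ ∈ Icc 1 (q ^ 2 / d₁ / t₁),
          ∑ f₂ ∈ Icc 1 (⌊KMV2000.qhat q ^ Δ'⌋₊ / d₂ / s₂), ∑ h₂ ∈ Icc 1 (q ^ 2 / d₂ / t₂),
            (if Nat.Coprime f₁ (q * r) ∧ Nat.Coprime f₂ (q * r) then
                (KMV2000.mollifierCoeff P (KMV2000.qhat q ^ Δ') (d₁ * (s₁ * f₁)) : ℂ) *
                  (KMV2000.mollifierCoeff P (KMV2000.qhat q ^ Δ') (d₂ * (s₂ * f₂)) : ℂ) *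
                  ((Real.sqrt ((s₁ * f₁ : ℕ) : ℝ) * Real.sqrt ((s₂ * f₂ : ℕ) : ℝ) : ℝ) : ℂ) else 0) *
              (if Nat.Coprime h₁ (q * r) ∧ Nat.Coprime h₂ (q * r) then
                  (if d₁ * (t₁ * h₁) * (d₂ * (t₂ * h₂)) ≤ Y then
                      ((((((d₁ * (t₁ * h₁) : ℕ) : ℝ) * ((d₂ * (t₂ * h₂) : ℕ) : ℝ)) ^ (-(1 / 2 : ℝ)) : ℝ) : ℂ) *
                        afeW (KMV2000.qhat q) i j (d₁ * (t₁ * h₁)) (d₂ * (t₂ * h₂))) else 0) *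
                    ((Real.sqrt ((t₁ * h₁ : ℕ) : ℝ) * Real.sqrt ((t₂ * h₂ : ℕ) : ℝ) : ℝ) : ℂ) else 0) *
              kloostermanSum (q * r / g) ((s₁ * t₁ / g * (f₁ * f₂) : ℕ) : ZMod (q * r / g))
                ((s₂ * t₂ / g * (h₁ * h₂) : ℕ) : ZMod (q * r / g))‖ ≤
          C * Real.sqrt D₁ * Real.sqrt D₂ *
            (B ^ 2 * Real.sqrt (((⌊KMV2000.qhat q ^ Δ'⌋₊ / d₁ / s₁ : ℕ) : ℝ) * ((⌊KMV2000.qhat q ^ Δ'⌋₊ / d₂ / s₂ : ℕ) : ℝ))) *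
            (K * ((1 + Real.log (KMV2000.qhat q)) * (1 + 2 * Real.log q)) ^ (i + j) *
              Real.sqrt ((1 + 2 * Real.log q) * ((Y : ℝ) / (((d₁ * t₁ : ℕ) : ℝ) * ((d₂ * t₂ : ℕ) : ℝ))))) *
            ((q * r / g : ℕ) : ℝ) ^ (1 + ε) *
            (Pascadi2025.bracket71 (s₁ * t₁ / g * ((⌊KMV2000.qhat q ^ Δ'⌋₊ / d₁ / s₁) * (⌊KMV2000.qhat q ^ Δ'⌋₊ / d₂ / s₂)) : ℕ) (s₂ * t₂ / g * (Y / (d₁ * t₁ * (d₂ * t₂))) : ℕ) ((q * r / g : ℕ) : ℝ) (r / g : ℕ) (r / g : ℕ)) ^ (1 / 6 : ℝ) := by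
  obtain ⟨C, hC0, hC⟩ := norm_sum_four_le_of_pascadi_hyperbolic h hε
  refine ⟨C, hC0, ?_⟩
  intro q _ h64 hq r hqr P B hB Δ' hΔ' i j K hK0 hK Y d₁ d₂ s₁ t₁ s₂ t₂ g _ hd₁ hd₂ hs₁ hs₂ ht₁ ht₂ hg hσ
    hN hNM hMc hV D₁ D₂ hD₁0 hD₂0 hD₁ hD₂
  have hqr0 : q * r ≠ 0 := by
    refine mul_ne_zero hq.ne_zero ?_
    rintro rfl; exact hqr (dvd_zero q)
  -- the class modulus `q r / g = q · (r/g)`, `q ∤ r/g`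
  obtain ⟨hgr, hcg⟩ := classGcd_dvd_right (r := r) (σ₂ := s₂ * t₂) hq hσ
  rw [← hg] at hgr hcg
  have hqr' : ¬ q ∣ r / g := fun hd ↦ hqr (by rw [← Nat.div_mul_cancel hgr]; exact hd.mul_right g)
  -- the dilations are positive
  have hgpos : 0 < g := by rw [hg]; exact Nat.pos_of_ne_zero (Nat.gcd_ne_zero_right hqr0)
  have hgσ₁ : g ∣ s₁ * t₁ := by rw [hg]; exact (classGcd_dvd (s₁ * t₁) (s₂ * t₂) (q * r)).1
  have hgσ₂ : g ∣ s₂ * t₂ := by rw [hg]; exact (classGcd_dvd (s₁ * t₁) (s₂ * t₂) (q * r)).2.1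
  have hσ₁pos : 0 < s₁ * t₁ / g :=
    Nat.div_pos (Nat.le_of_dvd (Nat.mul_pos hs₁ ht₁) hgσ₁) hgpos
  have hσ₂pos : 0 < s₂ * t₂ / g :=
    Nat.div_pos (Nat.le_of_dvd (Nat.mul_pos hs₂ ht₂) hgσ₂) hgpos
  -- support and coprimality of the class coefficients
  have hD : 0 < d₁ * t₁ * (d₂ * t₂) := by positivity
  have hBsupp : ∀ n₁ n₂ : ℕ, Y / (d₁ * t₁ * (d₂ * t₂)) < n₁ * n₂ →
      (if Nat.Coprime n₁ (q * r) ∧ Nat.Coprime n₂ (q * r) then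
          (if d₁ * (t₁ * n₁) * (d₂ * (t₂ * n₂)) ≤ Y then
              ((((((d₁ * (t₁ * n₁) : ℕ) : ℝ) * ((d₂ * (t₂ * n₂) : ℕ) : ℝ)) ^ (-(1 / 2 : ℝ)) : ℝ) : ℂ) *
                afeW (KMV2000.qhat q) i j (d₁ * (t₁ * n₁)) (d₂ * (t₂ * n₂))) else 0) *
            ((Real.sqrt ((t₁ * n₁ : ℕ) : ℝ) * Real.sqrt ((t₂ * n₂ : ℕ) : ℝ) : ℝ) : ℂ) else 0) = 0 :=
    fun n₁ n₂ hlt ↦ classAFE_eq_zero_of_lt hD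
      (fun N₁ N₂ ↦ ((((N₁ : ℝ) * (N₂ : ℝ)) ^ (-(1 / 2 : ℝ)) : ℝ) : ℂ) * afeW (KMV2000.qhat q) i j N₁ N₂)
      (q * r) (fun n₁ n₂ ↦ ((Real.sqrt ((t₁ * n₁ : ℕ) : ℝ) * Real.sqrt ((t₂ * n₂ : ℕ) : ℝ) : ℝ) : ℂ)) hlt
  have hsupp : ∀ f₁ ∈ Icc 1 (⌊KMV2000.qhat q ^ Δ'⌋₊ / d₁ / s₁), ∀ f₂ ∈ Icc 1 (⌊KMV2000.qhat q ^ Δ'⌋₊ / d₂ / s₂),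
      ∀ h₁ ∈ Icc 1 (q ^ 2 / d₁ / t₁), ∀ h₂ ∈ Icc 1 (q ^ 2 / d₂ / t₂),
      (if Nat.Coprime f₁ (q * r) ∧ Nat.Coprime f₂ (q * r) then
          (KMV2000.mollifierCoeff P (KMV2000.qhat q ^ Δ') (d₁ * (s₁ * f₁)) : ℂ) *
            (KMV2000.mollifierCoeff P (KMV2000.qhat q ^ Δ') (d₂ * (s₂ * f₂)) : ℂ) *
            ((Real.sqrt ((s₁ * f₁ : ℕ) : ℝ) * Real.sqrt ((s₂ * f₂ : ℕ) : ℝ) : ℝ) : ℂ) else 0) *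
        (if Nat.Coprime h₁ (q * r) ∧ Nat.Coprime h₂ (q * r) then
            (if d₁ * (t₁ * h₁) * (d₂ * (t₂ * h₂)) ≤ Y then
                ((((((d₁ * (t₁ * h₁) : ℕ) : ℝ) * ((d₂ * (t₂ * h₂) : ℕ) : ℝ)) ^ (-(1 / 2 : ℝ)) : ℝ) : ℂ) *
                  afeW (KMV2000.qhat q) i j (d₁ * (t₁ * h₁)) (d₂ * (t₂ * h₂))) else 0) *
              ((Real.sqrt ((t₁ * h₁ : ℕ) : ℝ) * Real.sqrt ((t₂ * h₂ : ℕ) : ℝ) : ℝ) : ℂ) else 0) ≠ 0 →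
      Nat.Coprime (Nat.gcd (s₁ * t₁ / g * (f₁ * f₂)) (s₂ * t₂ / g * (h₁ * h₂))) (q * r / g) := by
    intro f₁ _ f₂ _ h₁ _ h₂ _ hne
    have key := coprime_of_classCoeff_ne_zero hqr0 s₁ t₁ s₂ t₂
      (fun m₁ m₂ ↦ (KMV2000.mollifierCoeff P (KMV2000.qhat q ^ Δ') (d₁ * m₁) : ℂ) *
        (KMV2000.mollifierCoeff P (KMV2000.qhat q ^ Δ') (d₂ * m₂) : ℂ) * ((Real.sqrt (m₁ : ℝ) * Real.sqrt (m₂ : ℝ) : ℝ) : ℂ))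
      (fun n₁ n₂ ↦ (if d₁ * n₁ * (d₂ * n₂) ≤ Y then
          (((((((d₁ * n₁ : ℕ)) : ℝ) * ((d₂ * n₂ : ℕ) : ℝ)) ^ (-(1 / 2 : ℝ)) : ℝ) : ℂ) *
            afeW (KMV2000.qhat q) i j (d₁ * n₁) (d₂ * n₂)) else 0) *
          ((Real.sqrt (n₁ : ℝ) * Real.sqrt (n₂ : ℝ) : ℝ) : ℂ))
      (f₁ := f₁) (h₁ := h₁) (f₂ := f₂) (h₂ := h₂) hne
    rw [← hg] at key
    exact key
  -- the per-class Pascadi inequality on the hyperbolic box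
  have main := hC (q * r / g) q (r / g) hcg hq hqr' (s₁ * t₁ / g) (s₂ * t₂ / g)
    (⌊KMV2000.qhat q ^ Δ'⌋₊ / d₁ / s₁) (⌊KMV2000.qhat q ^ Δ'⌋₊ / d₂ / s₂) (q ^ 2 / d₁ / t₁) (q ^ 2 / d₂ / t₂)
    (Y / (d₁ * t₁ * (d₂ * t₂))) hσ₁pos hσ₂pos hN hNM hMc hV _ _ hBsupp hsupp D₁ D₂ hD₁0 hD₂0 hD₁ hD₂
  refine main.trans ?_
  -- the `ℓ²` sizes
  obtain ⟨hAs, hBs⟩ := sqrt_classCoeff_le h64 hB hΔ' i j hK0 (fun hN₁ hN₂ ↦ hK hN₁ hN₂) (q * r) Y hd₁ hd₂ hs₁ hs₂ ht₁ ht₂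
  have hbr0 : 0 ≤ (Pascadi2025.bracket71 (s₁ * t₁ / g * ((⌊KMV2000.qhat q ^ Δ'⌋₊ / d₁ / s₁) * (⌊KMV2000.qhat q ^ Δ'⌋₊ / d₂ / s₂)) : ℕ) (s₂ * t₂ / g * (Y / (d₁ * t₁ * (d₂ * t₂))) : ℕ) ((q * r / g : ℕ) : ℝ) (r / g : ℕ) (r / g : ℕ)) ^ (1 / 6 : ℝ) := by
    refine Real.rpow_nonneg ?_ _
    unfold Pascadi2025.bracket71
    positivity
  have hX0 : 0 ≤ C * Real.sqrt D₁ * Real.sqrt D₂ := by positivity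
  have hB0 : 0 ≤ B := le_trans (abs_nonneg _) (hB 0 (by simp))
  refine mul_le_mul_of_nonneg_right (mul_le_mul_of_nonneg_right ?_ (Real.rpow_nonneg (Nat.cast_nonneg _) _)) hbr0
  exact mul_le_mul (mul_le_mul_of_nonneg_left hAs hX0) hBs (Real.sqrt_nonneg _) (by positivity)

/-- **The per-class bound, ordering `σ₂'V ≤ σ₁'Z₁Z₂ ≤ qr/g`** (CONDITIONAL on `pascadi2025_theorem71`; `q ≥ 64` prime, `q ∤ r`,
class `(s₁,t₁,s₂,t₂)` with `q ∤ s₁ * t₁`, `g = ((s₁t₁,s₂t₂),qr)`; divisor bounds `D₁, D₂` as hypotheses).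
[cite: Pascadi2025, Thm. 7.1 (case c = q·(r/g), a = 1)] -/
theorem norm_classForm_le_of_pascadi' (h : pascadi2025_theorem71) {ε : ℝ} (hε : 0 < ε) :
    ∃ C : ℝ, 0 ≤ C ∧ ∀ (q : ℕ) [NeZero q], 64 ≤ q → q.Prime → ∀ (r : ℕ), ¬ q ∣ r →
      ∀ (P : ℝ[X]) (B : ℝ), (∀ t ∈ Set.Icc (0 : ℝ) 1, |P.eval t| ≤ B) → ∀ (Δ' : ℝ), 0 < Δ' →
      ∀ (i j : ℕ) (K : ℝ), 0 ≤ K →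
        (∀ {N₁ N₂ : ℕ}, N₁ ∈ afeBox q → N₂ ∈ afeBox q →
          ‖((((N₁ : ℝ) * N₂) ^ (-(1 / 2 : ℝ)) : ℝ) : ℂ) * afeW (KMV2000.qhat q) i j N₁ N₂‖ *
              Real.sqrt ((N₁ : ℝ) * N₂) ≤
            K * ((1 + Real.log (KMV2000.qhat q)) * (1 + 2 * Real.log q)) ^ (i + j) *
              (KMV2000.qhat q ^ 2 / ((N₁ : ℝ) * N₂)) ^ (0 : ℝ)) →
      ∀ (Y d₁ d₂ s₁ t₁ s₂ t₂ g : ℕ) [NeZero (q * r / g)],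
        1 ≤ d₁ → 1 ≤ d₂ → 1 ≤ s₁ → 1 ≤ s₂ → 1 ≤ t₁ → 1 ≤ t₂ →
        g = Nat.gcd (Nat.gcd (s₁ * t₁) (s₂ * t₂)) (q * r) → ¬ q ∣ s₁ * t₁ →
        1 ≤ s₁ * t₁ / g * ((⌊KMV2000.qhat q ^ Δ'⌋₊ / d₁ / s₁) * (⌊KMV2000.qhat q ^ Δ'⌋₊ / d₂ / s₂)) → s₁ * t₁ / g * ((⌊KMV2000.qhat q ^ Δ'⌋₊ / d₁ / s₁) * (⌊KMV2000.qhat q ^ Δ'⌋₊ / d₂ / s₂)) ≤ s₂ * t₂ / g * (Y / (d₁ * t₁ * (d₂ * t₂))) →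
        s₂ * t₂ / g * (Y / (d₁ * t₁ * (d₂ * t₂))) ≤ q * r / g →
        Y / (d₁ * t₁ * (d₂ * t₂)) ≤ (q ^ 2 / d₁ / t₁) * (q ^ 2 / d₂ / t₂) →
      ∀ (D₁ D₂ : ℝ), 0 ≤ D₁ → 0 ≤ D₂ →
        (∀ u ∈ Icc 1 ((⌊KMV2000.qhat q ^ Δ'⌋₊ / d₁ / s₁) * (⌊KMV2000.qhat q ^ Δ'⌋₊ / d₂ / s₂)), (#u.divisors : ℝ) ≤ D₁) →
        (∀ v ∈ Icc 1 ((q ^ 2 / d₁ / t₁) * (q ^ 2 / d₂ / t₂)), (#v.divisors : ℝ) ≤ D₂) →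
        ‖∑ f₁ ∈ Icc 1 (⌊KMV2000.qhat q ^ Δ'⌋₊ / d₁ / s₁), ∑ h₁ ∈ Icc 1 (q ^ 2 / d₁ / t₁),
          ∑ f₂ ∈ Icc 1 (⌊KMV2000.qhat q ^ Δ'⌋₊ / d₂ / s₂), ∑ h₂ ∈ Icc 1 (q ^ 2 / d₂ / t₂),
            (if Nat.Coprime f₁ (q * r) ∧ Nat.Coprime f₂ (q * r) then
                (KMV2000.mollifierCoeff P (KMV2000.qhat q ^ Δ') (d₁ * (s₁ * f₁)) : ℂ) *
                  (KMV2000.mollifierCoeff P (KMV2000.qhat q ^ Δ') (d₂ * (s₂ * f₂)) : ℂ) *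
                  ((Real.sqrt ((s₁ * f₁ : ℕ) : ℝ) * Real.sqrt ((s₂ * f₂ : ℕ) : ℝ) : ℝ) : ℂ) else 0) *
              (if Nat.Coprime h₁ (q * r) ∧ Nat.Coprime h₂ (q * r) then
                  (if d₁ * (t₁ * h₁) * (d₂ * (t₂ * h₂)) ≤ Y then
                      ((((((d₁ * (t₁ * h₁) : ℕ) : ℝ) * ((d₂ * (t₂ * h₂) : ℕ) : ℝ)) ^ (-(1 / 2 : ℝ)) : ℝ) : ℂ) *
                        afeW (KMV2000.qhat q) i j (d₁ * (t₁ * h₁)) (d₂ * (t₂ * h₂))) else 0) *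
                    ((Real.sqrt ((t₁ * h₁ : ℕ) : ℝ) * Real.sqrt ((t₂ * h₂ : ℕ) : ℝ) : ℝ) : ℂ) else 0) *
              kloostermanSum (q * r / g) ((s₁ * t₁ / g * (f₁ * f₂) : ℕ) : ZMod (q * r / g))
                ((s₂ * t₂ / g * (h₁ * h₂) : ℕ) : ZMod (q * r / g))‖ ≤
          C * Real.sqrt D₁ * Real.sqrt D₂ *
            (B ^ 2 * Real.sqrt (((⌊KMV2000.qhat q ^ Δ'⌋₊ / d₁ / s₁ : ℕ) : ℝ) * ((⌊KMV2000.qhat q ^ Δ'⌋₊ / d₂ / s₂ : ℕ) : ℝ))) *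
            (K * ((1 + Real.log (KMV2000.qhat q)) * (1 + 2 * Real.log q)) ^ (i + j) *
              Real.sqrt ((1 + 2 * Real.log q) * ((Y : ℝ) / (((d₁ * t₁ : ℕ) : ℝ) * ((d₂ * t₂ : ℕ) : ℝ))))) *
            ((q * r / g : ℕ) : ℝ) ^ (1 + ε) *
            (Pascadi2025.bracket71 (s₂ * t₂ / g * (Y / (d₁ * t₁ * (d₂ * t₂))) : ℕ) (s₁ * t₁ / g * ((⌊KMV2000.qhat q ^ Δ'⌋₊ / d₁ / s₁) * (⌊KMV2000.qhat q ^ Δ'⌋₊ / d₂ / s₂)) : ℕ) ((q * r / g : ℕ) : ℝ) (r / g : ℕ) (r / g : ℕ)) ^ (1 / 6 : ℝ) := by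
  obtain ⟨C, hC0, hC⟩ := norm_sum_four_le_of_pascadi_hyperbolic' h hε
  refine ⟨C, hC0, ?_⟩
  intro q _ h64 hq r hqr P B hB Δ' hΔ' i j K hK0 hK Y d₁ d₂ s₁ t₁ s₂ t₂ g _ hd₁ hd₂ hs₁ hs₂ ht₁ ht₂ hg hσ
    hN hNM hMc hV D₁ D₂ hD₁0 hD₂0 hD₁ hD₂
  have hqr0 : q * r ≠ 0 := by
    refine mul_ne_zero hq.ne_zero ?_
    rintro rfl; exact hqr (dvd_zero q)
  -- the class modulus `q r / g = q · (r/g)`, `q ∤ r/g`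
  obtain ⟨hgr, hcg⟩ := classGcd_dvd_right (r := r) (σ₂ := s₂ * t₂) hq hσ
  rw [← hg] at hgr hcg
  have hqr' : ¬ q ∣ r / g := fun hd ↦ hqr (by rw [← Nat.div_mul_cancel hgr]; exact hd.mul_right g)
  -- the dilations are positive
  have hgpos : 0 < g := by rw [hg]; exact Nat.pos_of_ne_zero (Nat.gcd_ne_zero_right hqr0)
  have hgσ₁ : g ∣ s₁ * t₁ := by rw [hg]; exact (classGcd_dvd (s₁ * t₁) (s₂ * t₂) (q * r)).1
  have hgσ₂ : g ∣ s₂ * t₂ := by rw [hg]; exact (classGcd_dvd (s₁ * t₁) (s₂ * t₂) (q * r)).2.1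
  have hσ₁pos : 0 < s₁ * t₁ / g :=
    Nat.div_pos (Nat.le_of_dvd (Nat.mul_pos hs₁ ht₁) hgσ₁) hgpos
  have hσ₂pos : 0 < s₂ * t₂ / g :=
    Nat.div_pos (Nat.le_of_dvd (Nat.mul_pos hs₂ ht₂) hgσ₂) hgpos
  -- support and coprimality of the class coefficients
  have hD : 0 < d₁ * t₁ * (d₂ * t₂) := by positivity
  have hBsupp : ∀ n₁ n₂ : ℕ, Y / (d₁ * t₁ * (d₂ * t₂)) < n₁ * n₂ →
      (if Nat.Coprime n₁ (q * r) ∧ Nat.Coprime n₂ (q * r) then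
          (if d₁ * (t₁ * n₁) * (d₂ * (t₂ * n₂)) ≤ Y then
              ((((((d₁ * (t₁ * n₁) : ℕ) : ℝ) * ((d₂ * (t₂ * n₂) : ℕ) : ℝ)) ^ (-(1 / 2 : ℝ)) : ℝ) : ℂ) *
                afeW (KMV2000.qhat q) i j (d₁ * (t₁ * n₁)) (d₂ * (t₂ * n₂))) else 0) *
            ((Real.sqrt ((t₁ * n₁ : ℕ) : ℝ) * Real.sqrt ((t₂ * n₂ : ℕ) : ℝ) : ℝ) : ℂ) else 0) = 0 :=
    fun n₁ n₂ hlt ↦ classAFE_eq_zero_of_lt hD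
      (fun N₁ N₂ ↦ ((((N₁ : ℝ) * (N₂ : ℝ)) ^ (-(1 / 2 : ℝ)) : ℝ) : ℂ) * afeW (KMV2000.qhat q) i j N₁ N₂)
      (q * r) (fun n₁ n₂ ↦ ((Real.sqrt ((t₁ * n₁ : ℕ) : ℝ) * Real.sqrt ((t₂ * n₂ : ℕ) : ℝ) : ℝ) : ℂ)) hlt
  have hsupp : ∀ f₁ ∈ Icc 1 (⌊KMV2000.qhat q ^ Δ'⌋₊ / d₁ / s₁), ∀ f₂ ∈ Icc 1 (⌊KMV2000.qhat q ^ Δ'⌋₊ / d₂ / s₂),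
      ∀ h₁ ∈ Icc 1 (q ^ 2 / d₁ / t₁), ∀ h₂ ∈ Icc 1 (q ^ 2 / d₂ / t₂),
      (if Nat.Coprime f₁ (q * r) ∧ Nat.Coprime f₂ (q * r) then
          (KMV2000.mollifierCoeff P (KMV2000.qhat q ^ Δ') (d₁ * (s₁ * f₁)) : ℂ) *
            (KMV2000.mollifierCoeff P (KMV2000.qhat q ^ Δ') (d₂ * (s₂ * f₂)) : ℂ) *
            ((Real.sqrt ((s₁ * f₁ : ℕ) : ℝ) * Real.sqrt ((s₂ * f₂ : ℕ) : ℝ) : ℝ) : ℂ) else 0) *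
        (if Nat.Coprime h₁ (q * r) ∧ Nat.Coprime h₂ (q * r) then
            (if d₁ * (t₁ * h₁) * (d₂ * (t₂ * h₂)) ≤ Y then
                ((((((d₁ * (t₁ * h₁) : ℕ) : ℝ) * ((d₂ * (t₂ * h₂) : ℕ) : ℝ)) ^ (-(1 / 2 : ℝ)) : ℝ) : ℂ) *
                  afeW (KMV2000.qhat q) i j (d₁ * (t₁ * h₁)) (d₂ * (t₂ * h₂))) else 0) *
              ((Real.sqrt ((t₁ * h₁ : ℕ) : ℝ) * Real.sqrt ((t₂ * h₂ : ℕ) : ℝ) : ℝ) : ℂ) else 0) ≠ 0 →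
      Nat.Coprime (Nat.gcd (s₁ * t₁ / g * (f₁ * f₂)) (s₂ * t₂ / g * (h₁ * h₂))) (q * r / g) := by
    intro f₁ _ f₂ _ h₁ _ h₂ _ hne
    have key := coprime_of_classCoeff_ne_zero hqr0 s₁ t₁ s₂ t₂
      (fun m₁ m₂ ↦ (KMV2000.mollifierCoeff P (KMV2000.qhat q ^ Δ') (d₁ * m₁) : ℂ) *
        (KMV2000.mollifierCoeff P (KMV2000.qhat q ^ Δ') (d₂ * m₂) : ℂ) * ((Real.sqrt (m₁ : ℝ) * Real.sqrt (m₂ : ℝ) : ℝ) : ℂ))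
      (fun n₁ n₂ ↦ (if d₁ * n₁ * (d₂ * n₂) ≤ Y then
          (((((((d₁ * n₁ : ℕ)) : ℝ) * ((d₂ * n₂ : ℕ) : ℝ)) ^ (-(1 / 2 : ℝ)) : ℝ) : ℂ) *
            afeW (KMV2000.qhat q) i j (d₁ * n₁) (d₂ * n₂)) else 0) *
          ((Real.sqrt (n₁ : ℝ) * Real.sqrt (n₂ : ℝ) : ℝ) : ℂ))
      (f₁ := f₁) (h₁ := h₁) (f₂ := f₂) (h₂ := h₂) hne
    rw [← hg] at key
    exact key
  -- the per-class Pascadi inequality on the hyperbolic box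
  have main := hC (q * r / g) q (r / g) hcg hq hqr' (s₁ * t₁ / g) (s₂ * t₂ / g)
    (⌊KMV2000.qhat q ^ Δ'⌋₊ / d₁ / s₁) (⌊KMV2000.qhat q ^ Δ'⌋₊ / d₂ / s₂) (q ^ 2 / d₁ / t₁) (q ^ 2 / d₂ / t₂)
    (Y / (d₁ * t₁ * (d₂ * t₂))) hσ₁pos hσ₂pos hN hNM hMc hV _ _ hBsupp hsupp D₁ D₂ hD₁0 hD₂0 hD₁ hD₂
  refine main.trans ?_
  -- the `ℓ²` sizes
  obtain ⟨hAs, hBs⟩ := sqrt_classCoeff_le h64 hB hΔ' i j hK0 (fun hN₁ hN₂ ↦ hK hN₁ hN₂) (q * r) Y hd₁ hd₂ hs₁ hs₂ ht₁ ht₂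
  have hbr0 : 0 ≤ (Pascadi2025.bracket71 (s₂ * t₂ / g * (Y / (d₁ * t₁ * (d₂ * t₂))) : ℕ) (s₁ * t₁ / g * ((⌊KMV2000.qhat q ^ Δ'⌋₊ / d₁ / s₁) * (⌊KMV2000.qhat q ^ Δ'⌋₊ / d₂ / s₂)) : ℕ) ((q * r / g : ℕ) : ℝ) (r / g : ℕ) (r / g : ℕ)) ^ (1 / 6 : ℝ) := by
    refine Real.rpow_nonneg ?_ _
    unfold Pascadi2025.bracket71
    positivity
  have hX0 : 0 ≤ C * Real.sqrt D₁ * Real.sqrt D₂ := by positivity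
  have hB0 : 0 ≤ B := le_trans (abs_nonneg _) (hB 0 (by simp))
  refine mul_le_mul_of_nonneg_right (mul_le_mul_of_nonneg_right ?_ (Real.rpow_nonneg (Nat.cast_nonneg _) _)) hbr0
  exact mul_le_mul (mul_le_mul_of_nonneg_left hAs hX0) hBs (Real.sqrt_nonneg _) (by positivity)

end Summit.Parity.GeneralizedHardyLittlewood.Theorems.MomentsBeyondDiagonal.Layers

end
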